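import Mathlib
import Summits.PneNP.PneNP.Theorems.ChebyshevTracialDesignJuntaCount
import HarnessLib

/-!
# Dipole vanishing: a dipole product averages to zero over every level class unless all dipoles are hit

Support file for the crux `TracialDecayExp20` (stmt-PneNP-19878) of route `ChebyshevTracialDesign`
(cell pnp-psdrank; eng MEMO-6 §2 «dipole route to the attenuation estimate (ATT)»; the same relabelling mechanism
as prover g4's `ChebyshevTracialDesignVertexTransitive`, here in the junta files' `IsPMOn`/`cutCount` vocabulary).

For a perfect matching `M` of `S` and a dipole product `φ(U) = ∏_{i∈I} (1[a_i ∈ U] − 1[b_i ∈ U])`: if one dipole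
`{a, b}` has its `M`-partners `p, q` outside the dipole points, the double transposition `π = (a b)(p q)` fixes
`M` (hence every level class `{U ⊆ S : #cr(U,M) = c, #in(U,M) = j}`), fixes the other dipole points and swaps
`a ↔ b`, so `φ ∘ π = −φ` and `Σ_{level class} φ = 0` (`dipole_level_sum_eq_zero`). With the k-dipole test vector
`φ_k ∈ V_{(n−k,k)}` this gives `E[φ_k | cc(U,M) = c] = 0` unless every dipole has an endpoint matched inside the
`2k` dipole points, whence the uniform-in-`c` bound `σ_k(c)² ≤ P_M[all dipoles hit]/‖φ_k‖² = (Ck/n)^{k/2}`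
(numbers and the exact n ≤ 12 cross-check: kit j252893, HOME/pnp-psdrank-eng/MEMO-6.md).
WHAT THIS IS NOT: the Johnson-scheme facts (`φ_k` spans the mode `(n−k,k)`; class-function kernels act as
scalars) and the probability count are not in this file. No definitions.
-/

set_option linter.dupNamespace false -- `Summit.PneNP.PneNP.…`: summit = sub-problem (D-0017)

namespace Summit.PneNP.PneNP.Theorems.ChebyshevTracialDesignHalfDegree

open Finset

section Dipole

open Literature.Barriers.PneNP

variable {V : Type*} [DecidableEq V]

/-- The double transposition `(a b)(p q)` as a function (all other points fixed). [folklore] -/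
theorem dswap_invol {a b p q : V} (hab : a ≠ b) (hap : a ≠ p) (haq : a ≠ q) (hbp : b ≠ p) (hbq : b ≠ q)
    (hpq : p ≠ q) (v : V) :
    (fun w => if w = a then b else if w = b then a else if w = p then q else if w = q then p else w)
      ((fun w => if w = a then b else if w = b then a else if w = p then q else if w = q then p else w) v) = v := by
  dsimp only
  rcases eq_or_ne v a with rfl | h1
  · rw [if_pos rfl, if_neg hab.symm, if_pos rfl]
  rcases eq_or_ne v b with rfl | h2
  · rw [if_neg h1, if_pos rfl, if_pos rfl]
  rcases eq_or_ne v p with rfl | h3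
  · rw [if_neg h1, if_neg h2, if_pos rfl, if_neg haq.symm, if_neg hbq.symm, if_neg hpq.symm, if_pos rfl]
  rcases eq_or_ne v q with rfl | h4
  · rw [if_neg h1, if_neg h2, if_neg h3, if_pos rfl, if_neg hap.symm, if_neg hbp.symm, if_pos rfl]
  · rw [if_neg h1, if_neg h2, if_neg h3, if_neg h4, if_neg h1, if_neg h2, if_neg h3, if_neg h4]

/-- Membership in the image under an involution `π`: `v ∈ π(U) ↔ π v ∈ U`. [folklore] -/
theorem mem_image_of_invol {π : V → V} (hπ : ∀ v, π (π v) = v) {U : Finset V} {v : V} :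
    v ∈ U.image π ↔ π v ∈ U := by
  rw [mem_image]
  constructor
  · rintro ⟨w, hw, rfl⟩; rwa [hπ]
  · intro h; exact ⟨π v, h, hπ v⟩

/-- `cutCount (π U) e = cutCount U (π e)` for an involution `π`. [folklore] -/
theorem cutCount_image_of_invol {π : V → V} (hπ : ∀ v, π (π v) = v) (U : Finset V) (e : Sym2 V) :
    cutCount (U.image π) e = cutCount U (Sym2.map π e) := by
  induction e using Sym2.ind with
  | h x y => simp only [cutCount_mk, Sym2.map_mk, mem_image_of_invol hπ]

/-- An involution `π` of the vertices mapping the perfect matching `M` into itself preserves the crossing and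
internal edge counts: `#{e ∈ M : cutCount (πU) e = j} = #{e ∈ M : cutCount U e = j}`. [folklore] -/
theorem card_filter_cutCount_image_of_invol {π : V → V} (hπ : ∀ v, π (π v) = v) {M : Finset (Sym2 V)}
    (hM : ∀ e ∈ M, Sym2.map π e ∈ M) (U : Finset V) (j : ℕ) :
    (M.filter fun e => cutCount (U.image π) e = j).card = (M.filter fun e => cutCount U e = j).card := by
  have hee : ∀ e : Sym2 V, Sym2.map π (Sym2.map π e) = e := fun e => by
    induction e using Sym2.ind with
    | h x y => simp [hπ]
  refine card_nbij' (fun e => Sym2.map π e) (fun e => Sym2.map π e) (fun e he => ?_) (fun e he => ?_)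
    (fun e _ => hee e) (fun e _ => hee e)
  · rw [mem_coe, mem_filter] at he ⊢
    exact ⟨hM e he.1, by rw [← cutCount_image_of_invol hπ]; exact he.2⟩
  · rw [mem_coe, mem_filter] at he ⊢
    exact ⟨hM e he.1, by rw [cutCount_image_of_invol hπ, hee]; exact he.2⟩

/-- **Dipole vanishing** (eng MEMO-6 §2 (V); the mechanism of prover g4's vertex-transitivity file): let `M` be a
perfect matching of `S`, and `φ(U) = ∏_{i∈I} (1[a_i ∈ U] − 1[b_i ∈ U])` a product of dipoles. If some dipole
`{a_{i₀}, b_{i₀}}` has its two `M`-partners `p, q` outside all dipole points (the edges `a_{i₀}p`, `b_{i₀}q ∈ M`, with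
`a_{i₀}, b_{i₀}, p, q` distinct and `p, q, a_{i₀}, b_{i₀}` different from every other `a_i, b_i`), then `φ` sums to `0`
over every level class `{U ⊆ S : #cr(U,M) = c, #in(U,M) = i}`: the double transposition `(a_{i₀} b_{i₀})(p q)` fixes
`M`, permutes the level class and flips the sign of `φ`. Consequently the `k`-dipole test vector sees, in
`E_M[E[φ | cc = c]²]`, only the matchings in which every dipole is hit internally (probability `(O(k/n))^{k/2}`).
[folklore] -/
theorem dipole_level_sum_eq_zero {ι : Type*} {S : Finset V} {M : Finset (Sym2 V)} (hM : IsPMOn S M)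
    (I : Finset ι) (a b : ι → V) {i₀ : ι} (hi₀ : i₀ ∈ I) {p q : V}
    (hap : s(a i₀, p) ∈ M) (hbq : s(b i₀, q) ∈ M) (hab : a i₀ ≠ b i₀) (hpq : p ≠ q) (haq : a i₀ ≠ q)
    (hbp : b i₀ ≠ p)
    (hfix : ∀ i ∈ I, i ≠ i₀ → a i ≠ a i₀ ∧ a i ≠ b i₀ ∧ a i ≠ p ∧ a i ≠ q ∧
      b i ≠ a i₀ ∧ b i ≠ b i₀ ∧ b i ≠ p ∧ b i ≠ q) (c j : ℕ) :
    ∑ U ∈ S.powerset.filter (fun U => (M.filter fun e => cutCount U e = 1).card = c ∧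
        (M.filter fun e => cutCount U e = 2).card = j),
      ∏ i ∈ I, ((if a i ∈ U then (1 : ℝ) else 0) - (if b i ∈ U then (1 : ℝ) else 0)) = 0 := by
  classical
  have hap' : a i₀ ≠ p := fun h => hM.not_isDiag hap (by rw [h]; exact Sym2.mk_isDiag_iff.2 rfl)
  have hbq' : b i₀ ≠ q := fun h => hM.not_isDiag hbq (by rw [h]; exact Sym2.mk_isDiag_iff.2 rfl)
  set π : V → V := fun w => if w = a i₀ then b i₀ else if w = b i₀ then a i₀ else if w = p then q
    else if w = q then p else w with hπdef
  have hπ : ∀ v, π (π v) = v := dswap_invol hab hap' haq hbp hbq' hpq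
  have hπa : π (a i₀) = b i₀ := by simp [hπdef]
  have hπb : π (b i₀) = a i₀ := by simp [hπdef, hab.symm]
  have hπp : π p = q := by simp [hπdef, hap'.symm, hbp.symm]
  have hπq : π q = p := by simp [hπdef, haq.symm, hbq'.symm, hpq.symm]
  have hπfix : ∀ w, w ≠ a i₀ → w ≠ b i₀ → w ≠ p → w ≠ q → π w = w := fun w h1 h2 h3 h4 => by
    simp [hπdef, h1, h2, h3, h4]
  -- the four special points lie in `S`
  have haS : a i₀ ∈ S := hM.mem_of_mem hap (Sym2.mem_mk_left _ _)
  have hpS : p ∈ S := hM.mem_of_mem hap (Sym2.mem_mk_right _ _)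
  have hbS : b i₀ ∈ S := hM.mem_of_mem hbq (Sym2.mem_mk_left _ _)
  have hqS : q ∈ S := hM.mem_of_mem hbq (Sym2.mem_mk_right _ _)
  have hπS : ∀ w, w ∈ S → π w ∈ S := by
    intro w hw
    by_cases h1 : w = a i₀; · rw [h1, hπa]; exact hbS
    by_cases h2 : w = b i₀; · rw [h2, hπb]; exact haS
    by_cases h3 : w = p; · rw [h3, hπp]; exact hqS
    by_cases h4 : w = q; · rw [h4, hπq]; exact hpS
    rw [hπfix w h1 h2 h3 h4]; exact hw
  -- `π` maps `M` into itself
  have hMπ : ∀ e ∈ M, Sym2.map π e ∈ M := by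
    intro e he
    by_cases h1 : e = s(a i₀, p)
    · rw [h1, Sym2.map_mk, hπa, hπp]; exact hbq
    by_cases h2 : e = s(b i₀, q)
    · rw [h2, Sym2.map_mk, hπb, hπq]; exact hap
    · -- `e` avoids the four points, so it is fixed
      have hav : ∀ v ∈ e, v ≠ a i₀ ∧ v ≠ b i₀ ∧ v ≠ p ∧ v ≠ q := by
        intro v hv
        refine ⟨fun h => h1 ?_, fun h => h2 ?_, fun h => h1 ?_, fun h => h2 ?_⟩
        · exact hM.unique he hap (h ▸ hv) (Sym2.mem_mk_left _ _)
        · exact hM.unique he hbq (h ▸ hv) (Sym2.mem_mk_left _ _)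
        · exact hM.unique he hap (h ▸ hv) (Sym2.mem_mk_right _ _)
        · exact hM.unique he hbq (h ▸ hv) (Sym2.mem_mk_right _ _)
      have : Sym2.map π e = e := by
        induction e using Sym2.ind with
        | h x y =>
          obtain ⟨hx1, hx2, hx3, hx4⟩ := hav x (Sym2.mem_mk_left x y)
          obtain ⟨hy1, hy2, hy3, hy4⟩ := hav y (Sym2.mem_mk_right x y)
          rw [Sym2.map_mk, hπfix x hx1 hx2 hx3 hx4, hπfix y hy1 hy2 hy3 hy4]
      rw [this]; exact he
  -- the sign flip
  have hflip : ∀ U : Finset V, ∏ i ∈ I, ((if a i ∈ U.image π then (1 : ℝ) else 0) -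
      (if b i ∈ U.image π then (1 : ℝ) else 0)) =
      -∏ i ∈ I, ((if a i ∈ U then (1 : ℝ) else 0) - (if b i ∈ U then (1 : ℝ) else 0)) := by
    intro U
    rw [← mul_prod_erase I _ hi₀, ← mul_prod_erase I (fun i => (if a i ∈ U then (1 : ℝ) else 0) -
      (if b i ∈ U then (1 : ℝ) else 0)) hi₀, neg_mul_eq_neg_mul]
    have hmem : ∀ v, v ∈ U.image π ↔ π v ∈ U := fun v => mem_image_of_invol hπ
    congr 1
    · simp only [hmem, hπa, hπb]; ring
    · refine prod_congr rfl fun i hi => ?_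
      obtain ⟨hne, hiI⟩ := mem_erase.1 hi
      obtain ⟨h1, h2, h3, h4, h5, h6, h7, h8⟩ := hfix i hiI hne
      simp only [hmem, hπfix _ h1 h2 h3 h4, hπfix _ h5 h6 h7 h8]
  -- reindex the level sum by the involution `U ↦ π(U)`
  have hUU : ∀ U : Finset V, (U.image π).image π = U := fun U => by
    rw [image_image]
    conv_rhs => rw [← image_id (s := U)]
    exact image_congr fun v _ => hπ v
  have hsum := sum_nbij' (s := S.powerset.filter (fun U => (M.filter fun e => cutCount U e = 1).card = c ∧
        (M.filter fun e => cutCount U e = 2).card = j))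
      (t := S.powerset.filter (fun U => (M.filter fun e => cutCount U e = 1).card = c ∧
        (M.filter fun e => cutCount U e = 2).card = j))
      (f := fun U => ∏ i ∈ I, ((if a i ∈ U then (1 : ℝ) else 0) - (if b i ∈ U then (1 : ℝ) else 0)))
      (g := fun U => ∏ i ∈ I, ((if a i ∈ U.image π then (1 : ℝ) else 0) - (if b i ∈ U.image π then (1 : ℝ) else 0)))
      (fun U => U.image π) (fun U => U.image π) ?_ ?_ (fun U _ => hUU U) (fun U _ => hUU U) (fun U _ => by rw [hUU])
  · rw [sum_congr rfl fun U _ => hflip U, sum_neg_distrib] at hsum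
    linarith
  all_goals
    intro U hU
    rw [mem_filter, mem_powerset] at hU ⊢
    obtain ⟨hUS, hc, hj⟩ := hU
    refine ⟨fun v hv => ?_, ?_, ?_⟩
    · obtain ⟨w, hw, rfl⟩ := mem_image.1 hv
      exact hπS w (hUS hw)
    · rw [card_filter_cutCount_image_of_invol hπ hMπ]; exact hc
    · rw [card_filter_cutCount_image_of_invol hπ hMπ]; exact hj

end Dipole

end Summit.PneNP.PneNP.Theorems.ChebyshevTracialDesignHalfDegree
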